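/-
Copyright (c) 2026 the pub-hodgecm-mathlib formalisation cell (harness21).  Prover seat hodgecm-mathlib-K2E1-p15 (g3), Track B ∕ K2-LIT, h413 = `stmt-HodgeConjecture-24833`,
R90-TF section S8 «ContSpec-n½», (V) road of B's MID socket, deal S8-R153 (N = 2 twin, offer (e1)): the (E2-bd) letter `hEbd` — the JOINT LOCAL BOUND of the continued `χ`-Eisenstein family of
`U(1,1)_{L∕L⁺}` — from the CORE's pointwise representation (E5) by Banach–Steinhaus on the evaluation functionals and the maximum principle (census `R90/S8/CENSUS-hEbd.K2E1-p15-g3.md`).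
-/
import Summits.HodgeConjecture.HodgeConjecture.Theorems.K2E1ChiEisensteinMeromorphicExportsU2GlobalEigen   -- ★ X2_χ core at `N = 2` (eigen edition): (E5); transitively ★ `exists_evalCLM`, ★ `quotFun_lift`, ★ `continuous_integral_mul_lift`, `HX`
import Summits.HodgeConjecture.HodgeConjecture.Theorems.K2E1ContinuedEisensteinResidueFunctionUThree       -- ★ (K2E2-p12): §1 rank-free `exists_forall_norm_le_of_isCompact_of_locally_bounded`, `norm_le_of_sphere_bound`
import Mathlib.Analysis.Normed.Operator.BanachSteinhaus
import HarnessLib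

/-!
# S8 (V) road — `K2E1ChiEisensteinJointLocalBoundCMTwo`: the letter (E2-bd) `hEbd` — «the continued Eisenstein family is LOCALLY JOINTLY BOUNDED off its pole set» — from the
# core's pointwise representation (E5), by BANACH–STEINHAUS on the evaluation functionals `Λ_g ∈ 𝓗_k(𝔛)*` and the MAXIMUM PRINCIPLE

Track B ∕ K2-LIT, crux h413 = `stmt-HodgeConjecture-24833`, route of record `HCCMUnconditional`; cell `hodgecm-mathlib`, R90-TF programme, section S8 «ContSpec-n½», the (V) road
(N = 2 consumers: ★ `K2E1EisensteinResidueLevelConstantU2Final`, ★ `K2E1ChiEisensteinDetTwistU2`, ★ `K2E1ContinuedEisensteinResidue*UTwo`, binder `hEbd`) — the `2 ↤ 3` twin of ★ p863548.  THEOREMS ONLY (no `def`, no `instance`, no `notation`, no named-fact hypothesis, no `sorry`; default heartbeats); lane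
`--supports stmt-HodgeConjecture-24833 --as helper` (count-neutral).  CLOSES NO SOCKET.  WHY A NEW ROAD: the ★ exports (`chiEisenstein_meromorphic_exports_level_cm_two`, eigen head
`…_of_letters_of_eigen`) print (E4) as SEPARATE continuity `∀ z ∉ P, Continuous (Ec z)` and holomorphy pointwise in `g`; from these alone a joint local bound does NOT follow (a pointwise
bounded family of holomorphic functions is locally bounded only on a dense open set — Osgood ∕ Baire; Runge-type counterexamples) — whence `hEbd` has been a standing letter estate-wide.
The CORE ★ `chiEisenstein_meromorphic_exports_core_of_packages_of_eigen` (N = 2) exports more: (E5) `Ec z g = ŝ_{n,j}(z)⁻¹ · ∫ h_{n,j}(y)·vX_n(z)((g y)⁻¹) dν_G` on `U n ∖ P`, with `vX_n`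
HOLOMORPHIC into the Hilbert space `𝓗_{k n}(𝔛)`.  There the joint bound is soft analysis:
(§1) for `z₀ ∈ U n ∖ P` with `ŝ_{n,j}(z₀) ≠ 0`: the evaluation functionals `Λ_g : 𝓗 → ℂ`, `Λ_g v = ∫ h(y) v((gy)⁻¹) dν_G` (★ `exists_evalCLM`) are POINTWISE bounded on a compact `K ∋ g`
(`g ↦ Λ_g v` is continuous, ★ `continuous_integral_mul_lift`), hence UNIFORMLY bounded in operator norm (Banach–Steinhaus, `𝓗` complete); `z ↦ ‖vX_n(z)‖` and `z ↦ |ŝ(z)|⁻¹` are continuous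
near `z₀`; so `|Ec z g| ≤ |ŝ(z)|⁻¹·‖Λ_g‖·‖vX_n(z)‖ ≤ M` on a closed disc around `z₀`, uniformly in `g ∈ K`;
(§2) for ANY `z₁ ∉ P`: `U n` (`n = max n₀ ⌈|z₁|⌉`) is co-discrete at `z₁` and `P` is closed, so a small circle around `z₁` lies in `U n ∖ P`; it is compact, so §1 bounds `Ec` on circle × `K`
(★ `exists_forall_norm_le_of_isCompact_of_locally_bounded`); each `z ↦ Ec z g` is holomorphic on the disc (`⊆ Pᶜ`), so the MAXIMUM PRINCIPLE (★ `norm_le_of_sphere_bound`) bounds it inside.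
* §1 `locally_bounded_at_good_point_cm_two` (Banach–Steinhaus step).  §2 **`locally_bounded_of_core_letters_cm_two`** — `∀ z₁ ∉ P, ∀ K compact, ∃ V ∈ 𝓝 z₁, ∃ M, ∀ z ∈ V, ∀ g ∈ K, ‖Ec z g‖ ≤ M`.
* §3 **`hEbd_of_core_letters_cm_two`** — the N = 2 consumers' binder BYTES on `{1 < Re} ∖ Sp`, under the pole-ledger inclusion `{1 < Re} ∖ Sp ⊆ Pᶜ`.
LETTERS = the core's own inputs (`h ŝ hcov U hUo hUD hUcd vX hvXd`) and three of its output clauses (`IsClosed P`, `∀ g, DifferentiableOn (Ec · g) Pᶜ`, (E5)) — all in hand wherever the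
core is called; SEQUEL (XS): the eigen ∕ level heads re-run keeping (E5) export `hEbd` next to (E1)–(E4).
HONEST LABEL: HC_CM is proved only modulo the 7 printed citations (2 remaining named inputs: hLiu418 = `stmt-HodgeConjecture-24832`, h413 = `stmt-HodgeConjecture-24833`) until
rung 0 closes; REL ≠ ★ ≠ BUILT; `hEbd` is ONE letter of the (V) road — paying it retires no socket by itself; count-neutral.

## References
* [BernsteinLapid2019] J. Bernstein, E. Lapid, *On the meromorphic continuation of Eisenstein series*, J. Amer. Math. Soc. 37 (2024), Thm 2.3, §4 (pp. 9–10).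
* [MoeglinWaldspurger1995] C. Mœglin, J.-L. Waldspurger, *Spectral Decomposition and Eisenstein Series* (1995), IV.1.8–IV.1.11.
* [Rudin1991] W. Rudin, *Functional Analysis*, 2nd ed. (1991), Thm 2.5 (Banach–Steinhaus).
* [Conway1978] J. B. Conway, *Functions of One Complex Variable I*, 2nd ed. (1978), VI §1 (maximum modulus).
-/

set_option autoImplicit false
set_option linter.dupNamespace false  -- the mandated namespace repeats the summit's segment (`HodgeConjecture.HodgeConjecture`)

noncomputable section

open MeasureTheory Filter Topology Set NumberField Metric
open scoped NNReal ENNReal ComplexConjugate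
open Literature.MeasureTheory.Group Literature.NumberTheory Literature.NumberTheory.Automorphic Literature.NumberTheory.Automorphic.UnitaryGroup AdelicGroupData
open Summit.HodgeConjecture.HodgeConjecture.Cruxes.H413.K2E1BorelEisensteinU
open Summit.HodgeConjecture.HodgeConjecture.Cruxes.H413.K2E1BLBorelSpacesU2Defs
open Summit.HodgeConjecture.HodgeConjecture.Cruxes.H413.K2E1BLBorelOperatorsU2Defs
open Summit.HodgeConjecture.HodgeConjecture.Cruxes.H413.K2E1BLEvaluationFunctionalU2 (exists_evalCLM)
open Summit.HodgeConjecture.HodgeConjecture.Cruxes.H413.K2E1BLLiftIntegrabilityU (quotFun_lift lift_quotientSubgroup_mul)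
open Summit.HodgeConjecture.HodgeConjecture.Cruxes.H413.K2E1SphericalEisensteinCoefficientCMTwo (continuous_integral_mul_lift)
open Summit.HodgeConjecture.HodgeConjecture.Cruxes.H413.K2E1ContinuedEisensteinResidueFunctionUThree (exists_forall_norm_le_of_isCompact_of_locally_bounded norm_le_of_sphere_bound)

namespace Summit.HodgeConjecture.HodgeConjecture.Cruxes.H413.K2E1ChiEisensteinJointLocalBoundCMTwo

variable (L : Type) [Field L] [NumberField L] [IsCMField L]
  [MeasurableSpace (quasiSplit (↥(maximalRealSubfield L)) L (IsCMField.complexConj L) 2).Adelic] [BorelSpace (quasiSplit (↥(maximalRealSubfield L)) L (IsCMField.complexConj L) 2).Adelic]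
  (μ : Measure (quasiSplit (↥(maximalRealSubfield L)) L (IsCMField.complexConj L) 2).automorphicQuotient) [(quasiSplit (↥(maximalRealSubfield L)) L (IsCMField.complexConj L) 2).IsAutomorphicMeasure μ]
  (νG : Measure (quasiSplit (↥(maximalRealSubfield L)) L (IsCMField.complexConj L) 2).Adelic) [νG.IsHaarMeasure] [νG.IsInvInvariant]

/-! ## §1 The Banach–Steinhaus step: a local joint bound at a good point of the ball -/

/-- **LOCAL JOINT BOUND AT A GOOD POINT** (`z₀ ∈ U n ∖ P` with `ŝ_{n,j}(z₀) ≠ 0`): if on `U n ∖ P ∩ {ŝ_{n,j} ≠ 0}` the family is `Ec z g = ŝ_{n,j}(z)⁻¹·∫ h_{n,j}(y)·vX_n(z)((gy)⁻¹) dν_G` with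
`vX_n` continuous on the open `U n`, `ŝ_{n,j}` continuous, `h_{n,j}` a real continuous compactly supported test function, then for every compact `K` there are a neighbourhood `V` of `z₀`
and `M` with `|Ec z g| ≤ M` for `z ∈ V`, `g ∈ K` — the evaluation functionals `Λ_g` (★ `exists_evalCLM`) are pointwise bounded on `K` (★ `continuous_integral_mul_lift`), hence uniformly
bounded (Banach–Steinhaus in the Hilbert space `𝓗_{k n}(𝔛)`). [cite: Rudin1991, Thm 2.5] [cite: BernsteinLapid2019, §4 pp. 9–10] -/
theorem locally_bounded_at_good_point_cm_two (k : ℕ → ℕ) (n : ℕ) {I : Type} (h : I → (quasiSplit (↥(maximalRealSubfield L)) L (IsCMField.complexConj L) 2).Adelic → ℂ) (j : I)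
    (hhc : Continuous (h j)) (hhs : HasCompactSupport (h j)) (hreal : ∀ x, conj (h j x) = h j x)
    (ŝ : I → ℂ → ℂ) (hŝ : Continuous (ŝ j))
    {U : Set ℂ} (hUo : IsOpen U) (vX : ℂ → HX (↥(maximalRealSubfield L)) L (IsCMField.complexConj L) 2 (k n) μ) (hvX : ContinuousOn vX U)
    {Ec : ℂ → (quasiSplit (↥(maximalRealSubfield L)) L (IsCMField.complexConj L) 2).Adelic → ℂ} {P : Set ℂ} (hPc : IsClosed P)
    (hE5 : ∀ g, ∀ z ∈ U, z ∉ P → ŝ j z ≠ 0 →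
      Ec z g = (ŝ j z)⁻¹ * ∫ y, h j y * ((vX z : HX (↥(maximalRealSubfield L)) L (IsCMField.complexConj L) 2 (k n) μ) : (quasiSplit (↥(maximalRealSubfield L)) L (IsCMField.complexConj L) 2).automorphicQuotient → ℂ) ((quasiSplit (↥(maximalRealSubfield L)) L (IsCMField.complexConj L) 2).toAutomorphicQuotient (g * y)⁻¹) ∂νG)
    {z₀ : ℂ} (hz₀U : z₀ ∈ U) (hz₀P : z₀ ∉ P) (hj : ŝ j z₀ ≠ 0) {K : Set (quasiSplit (↥(maximalRealSubfield L)) L (IsCMField.complexConj L) 2).Adelic} (hK : IsCompact K) :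
    ∃ V ∈ 𝓝 z₀, ∃ M : ℝ, ∀ z ∈ V, ∀ g ∈ K, ‖Ec z g‖ ≤ M := by
  haveI : νG.IsMulRightInvariant := by rw [← Measure.inv_eq_self νG]; infer_instance
  -- the evaluation functionals `Λ_g` of `(h j, g)` on `𝓗_{k n}(𝔛)` (★ P3-D), with their formula on ALL of `𝓗` (canonical lift, ★ `quotFun_lift`)
  have hΛex : ∀ g : (quasiSplit (↥(maximalRealSubfield L)) L (IsCMField.complexConj L) 2).Adelic, ∃ Λ : HX (↥(maximalRealSubfield L)) L (IsCMField.complexConj L) 2 (k n) μ →L[ℂ] ℂ,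
      ∀ v : HX (↥(maximalRealSubfield L)) L (IsCMField.complexConj L) 2 (k n) μ,
        Λ v = ∫ y, h j y * ((v : HX (↥(maximalRealSubfield L)) L (IsCMField.complexConj L) 2 (k n) μ) : (quasiSplit (↥(maximalRealSubfield L)) L (IsCMField.complexConj L) 2).automorphicQuotient → ℂ) ((quasiSplit (↥(maximalRealSubfield L)) L (IsCMField.complexConj L) 2).toAutomorphicQuotient (g * y)⁻¹) ∂νG := by
    intro g
    obtain ⟨Λ, hΛ⟩ := exists_evalCLM μ νG (k n) (h := fun x => (h j x).re) (Complex.continuous_re.comp hhc) (hhs.comp_left Complex.zero_re) g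
    have hre : ∀ x, ((((h j x).re : ℝ)) : ℂ) = h j x := fun x => Complex.conj_eq_iff_re.1 (hreal x)
    refine ⟨Λ, fun v => ?_⟩
    have hmem : MemLp ((quasiSplit (↥(maximalRealSubfield L)) L (IsCMField.complexConj L) 2).quotFun (fun y : (quasiSplit (↥(maximalRealSubfield L)) L (IsCMField.complexConj L) 2).Adelic => ((v : HX (↥(maximalRealSubfield L)) L (IsCMField.complexConj L) 2 (k n) μ) : (quasiSplit (↥(maximalRealSubfield L)) L (IsCMField.complexConj L) 2).automorphicQuotient → ℂ) ((quasiSplit (↥(maximalRealSubfield L)) L (IsCMField.complexConj L) 2).toAutomorphicQuotient y⁻¹))) 2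
        (μ.withDensity fun x => (((supHeight (↥(maximalRealSubfield L)) L (IsCMField.complexConj L) 2 x)⁻¹ ^ (2 * k n) : ℝ≥0) : ℝ≥0∞)) := by
      rw [quotFun_lift]; exact Lp.memLp v
    have htoHX : toHX (↥(maximalRealSubfield L)) L (IsCMField.complexConj L) 2 (k n) μ (fun y : (quasiSplit (↥(maximalRealSubfield L)) L (IsCMField.complexConj L) 2).Adelic => ((v : HX (↥(maximalRealSubfield L)) L (IsCMField.complexConj L) 2 (k n) μ) : (quasiSplit (↥(maximalRealSubfield L)) L (IsCMField.complexConj L) 2).automorphicQuotient → ℂ) ((quasiSplit (↥(maximalRealSubfield L)) L (IsCMField.complexConj L) 2).toAutomorphicQuotient y⁻¹)) hmem = v := by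
      have key : ∀ (f : (quasiSplit (↥(maximalRealSubfield L)) L (IsCMField.complexConj L) 2).automorphicQuotient → ℂ) (hf : MemLp f 2 (μ.withDensity fun x => (((supHeight (↥(maximalRealSubfield L)) L (IsCMField.complexConj L) 2 x)⁻¹ ^ (2 * k n) : ℝ≥0) : ℝ≥0∞))),
          f = ((v : HX (↥(maximalRealSubfield L)) L (IsCMField.complexConj L) 2 (k n) μ) : (quasiSplit (↥(maximalRealSubfield L)) L (IsCMField.complexConj L) 2).automorphicQuotient → ℂ) → hf.toLp f = v := by
        rintro f hf rfl; exact Lp.toLp_coeFn _ _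
      exact key _ hmem (quotFun_lift _)
    have e := (hΛ (fun y : (quasiSplit (↥(maximalRealSubfield L)) L (IsCMField.complexConj L) 2).Adelic => ((v : HX (↥(maximalRealSubfield L)) L (IsCMField.complexConj L) 2 (k n) μ) : (quasiSplit (↥(maximalRealSubfield L)) L (IsCMField.complexConj L) 2).automorphicQuotient → ℂ) ((quasiSplit (↥(maximalRealSubfield L)) L (IsCMField.complexConj L) 2).toAutomorphicQuotient y⁻¹)) (lift_quotientSubgroup_mul _) hmem).2
    rw [htoHX] at e
    rw [e]; simp only [hre]
  choose Λ hΛ using hΛex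
  -- Banach–Steinhaus: the functionals `Λ_g`, `g ∈ K`, are pointwise bounded (continuity in `g`, ★ `continuous_integral_mul_lift`), hence uniformly bounded
  have hpt : ∀ v : HX (↥(maximalRealSubfield L)) L (IsCMField.complexConj L) 2 (k n) μ, ∃ C : ℝ, ∀ g : ↥K, ‖Λ (g : (quasiSplit (↥(maximalRealSubfield L)) L (IsCMField.complexConj L) 2).Adelic) v‖ ≤ C := by
    intro v
    have hc : Continuous fun g : (quasiSplit (↥(maximalRealSubfield L)) L (IsCMField.complexConj L) 2).Adelic =>
        ∫ y, h j y * ((v : HX (↥(maximalRealSubfield L)) L (IsCMField.complexConj L) 2 (k n) μ) : (quasiSplit (↥(maximalRealSubfield L)) L (IsCMField.complexConj L) 2).automorphicQuotient → ℂ) ((quasiSplit (↥(maximalRealSubfield L)) L (IsCMField.complexConj L) 2).toAutomorphicQuotient (g * y)⁻¹) ∂νG :=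
      continuous_integral_mul_lift μ νG (k n) (Lp.memLp v) hhc hhs
    obtain ⟨C, hC⟩ := hK.exists_bound_of_continuousOn hc.continuousOn
    exact ⟨C, fun g => by rw [hΛ]; exact hC g g.2⟩
  obtain ⟨C, hC⟩ := banach_steinhaus (g := fun g : ↥K => Λ (g : (quasiSplit (↥(maximalRealSubfield L)) L (IsCMField.complexConj L) 2).Adelic)) hpt
  -- a closed disc around `z₀` inside `U ∖ P ∩ {ŝ ≠ 0}`, on which `z ↦ |ŝ z|⁻¹·‖vX z‖` is bounded
  have hO : IsOpen (U ∩ Pᶜ ∩ {z : ℂ | ŝ j z ≠ 0}) := (hUo.inter hPc.isOpen_compl).inter (isOpen_ne_fun hŝ continuous_const)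
  obtain ⟨ε, hε, hball⟩ := Metric.isOpen_iff.1 hO z₀ ⟨⟨hz₀U, hz₀P⟩, hj⟩
  have hsub : closedBall z₀ (ε / 2) ⊆ U ∩ Pᶜ ∩ {z : ℂ | ŝ j z ≠ 0} := (closedBall_subset_ball (by linarith)).trans hball
  have hcont : ContinuousOn (fun z => ‖(ŝ j z)⁻¹‖ * ‖vX z‖) (closedBall z₀ (ε / 2)) :=
    ((hŝ.continuousOn.inv₀ fun z hz => (hsub hz).2).norm).mul ((hvX.mono fun z hz => (hsub hz).1.1).norm)
  obtain ⟨B, hB⟩ := (isCompact_closedBall z₀ (ε / 2)).exists_bound_of_continuousOn hcont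
  refine ⟨closedBall z₀ (ε / 2), closedBall_mem_nhds z₀ (by linarith), B * max C 0, fun z hz g hg => ?_⟩
  have hzO := hsub hz
  rw [hE5 g z hzO.1.1 hzO.1.2 hzO.2, ← hΛ g (vX z), norm_mul]
  have h1 : ‖Λ g (vX z)‖ ≤ max C 0 * ‖vX z‖ :=
    (Λ g).le_of_opNorm_le ((hC ⟨g, hg⟩).trans (le_max_left _ _)) _
  have h2 : ‖(ŝ j z)⁻¹‖ * ‖vX z‖ ≤ B := by
    have := hB z hz
    rwa [Real.norm_eq_abs, abs_of_nonneg (mul_nonneg (norm_nonneg _) (norm_nonneg _))] at this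
  calc ‖(ŝ j z)⁻¹‖ * ‖Λ g (vX z)‖ ≤ ‖(ŝ j z)⁻¹‖ * (max C 0 * ‖vX z‖) := mul_le_mul_of_nonneg_left h1 (norm_nonneg _)
    _ = (‖(ŝ j z)⁻¹‖ * ‖vX z‖) * max C 0 := by ring
    _ ≤ B * max C 0 := mul_le_mul_of_nonneg_right h2 (le_max_right _ _)

/-! ## §2 Every point off the pole set: a circle in the good set, then the maximum principle -/

/-- **(E2-bd) FROM THE CORE'S LETTERS**: with the per-ball data of ★ `chiEisenstein_meromorphic_exports_core_of_packages_of_eigen` (`h ŝ hcov U hUo hUD hUcd vX hvXd`) and three of its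
output clauses (`IsClosed P`, `∀ g, DifferentiableOn (Ec · g) Pᶜ`, (E5)), the continued family is LOCALLY JOINTLY BOUNDED off `P`:
`∀ z₁ ∉ P, ∀ K compact, ∃ V ∈ 𝓝 z₁, ∃ M, ∀ z ∈ V, ∀ g ∈ K, ‖Ec z g‖ ≤ M` (§1 on a small circle around `z₁` inside `U n ∖ P`, finite subcover, maximum principle).
[cite: BernsteinLapid2019, Thm 2.3, §4] [cite: MoeglinWaldspurger1995, IV.1.8–IV.1.11] [cite: Conway1978, VI §1] -/
theorem locally_bounded_of_core_letters_cm_two (n₀ : ℕ) (k : ℕ → ℕ)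
    {I : ℕ → Type} (h : (n : ℕ) → I n → (quasiSplit (↥(maximalRealSubfield L)) L (IsCMField.complexConj L) 2).Adelic → ℂ) (hhc : ∀ n i, Continuous (h n i)) (hhs : ∀ n i, HasCompactSupport (h n i))
    (hreal : ∀ n i x, conj (h n i x) = h n i x)
    (ŝ : (n : ℕ) → I n → ℂ → ℂ) (hŝ : ∀ n i, Differentiable ℂ (ŝ n i))
    (hcov : ∀ n : ℕ, n₀ ≤ n → ∀ z ∈ Metric.ball (0 : ℂ) (n + 2), ∃ i, (ŝ n i z) ≠ 0)
    {U : ℕ → Set ℂ} (hUo : ∀ n : ℕ, n₀ ≤ n → IsOpen (U n)) (hUD : ∀ n : ℕ, n₀ ≤ n → U n ⊆ Metric.ball (0 : ℂ) (n + 2))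
    (hUcd : ∀ n : ℕ, n₀ ≤ n → ∀ z₀ ∈ Metric.ball (0 : ℂ) (n + 2), ∀ᶠ s in 𝓝[≠] z₀, s ∈ U n)
    (vX : (n : ℕ) → ℂ → HX (↥(maximalRealSubfield L)) L (IsCMField.complexConj L) 2 (k n) μ) (hvXd : ∀ n : ℕ, n₀ ≤ n → DifferentiableOn ℂ (vX n) (U n))
    {Ec : ℂ → (quasiSplit (↥(maximalRealSubfield L)) L (IsCMField.complexConj L) 2).Adelic → ℂ} {P : Set ℂ} (hPc : IsClosed P) (hEdiff : ∀ g, DifferentiableOn ℂ (fun z => Ec z g) Pᶜ)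
    (hE5 : ∀ g (n : ℕ), n₀ ≤ n → ∀ j, ∀ z ∈ U n, z ∉ P → (ŝ n j z) ≠ 0 →
      Ec z g = (ŝ n j z)⁻¹ * ∫ y, h n j y * ((vX n z : HX (↥(maximalRealSubfield L)) L (IsCMField.complexConj L) 2 (k n) μ) : (quasiSplit (↥(maximalRealSubfield L)) L (IsCMField.complexConj L) 2).automorphicQuotient → ℂ) ((quasiSplit (↥(maximalRealSubfield L)) L (IsCMField.complexConj L) 2).toAutomorphicQuotient (g * y)⁻¹) ∂νG) :
    ∀ z₁ : ℂ, z₁ ∉ P → ∀ K : Set (quasiSplit (↥(maximalRealSubfield L)) L (IsCMField.complexConj L) 2).Adelic, IsCompact K → ∃ V ∈ 𝓝 z₁, ∃ M : ℝ, ∀ z ∈ V, ∀ g ∈ K, ‖Ec z g‖ ≤ M := by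
  intro z₁ hz₁ K hK
  -- the ball index of `z₁`
  have hball : z₁ ∈ Metric.ball (0 : ℂ) (((max n₀ ⌈‖z₁‖⌉₊ : ℕ) : ℝ) + 2) := by
    rw [Metric.mem_ball, dist_zero_right]
    have h1 : ‖z₁‖ ≤ (⌈‖z₁‖⌉₊ : ℝ) := Nat.le_ceil ‖z₁‖
    have h2 : ((⌈‖z₁‖⌉₊ : ℕ) : ℝ) ≤ ((max n₀ ⌈‖z₁‖⌉₊ : ℕ) : ℝ) := by exact_mod_cast le_max_right n₀ ⌈‖z₁‖⌉₊
    linarith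
  have hn : n₀ ≤ max n₀ ⌈‖z₁‖⌉₊ := le_max_left _ _
  -- §1 at every point of the good set `U n ∖ P`
  have hloc : ∀ z₀ ∈ U (max n₀ ⌈‖z₁‖⌉₊) ∩ Pᶜ, ∃ V ∈ 𝓝 z₀, ∃ M : ℝ, ∀ z ∈ V, ∀ g ∈ K, ‖Ec z g‖ ≤ M := by
    rintro z₀ ⟨hz₀U, hz₀P⟩
    obtain ⟨j, hj⟩ := hcov _ hn z₀ (hUD _ hn hz₀U)
    exact locally_bounded_at_good_point_cm_two L μ νG k (max n₀ ⌈‖z₁‖⌉₊) (h (max n₀ ⌈‖z₁‖⌉₊)) j (hhc _ j) (hhs _ j) (hreal _ j) (ŝ (max n₀ ⌈‖z₁‖⌉₊)) (hŝ _ j).continuous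
      (hUo _ hn) (vX (max n₀ ⌈‖z₁‖⌉₊)) (hvXd _ hn).continuousOn hPc (fun g z hzU hzP hne => hE5 g _ hn j z hzU hzP hne) hz₀U hz₀P hj hK
  -- radii: a punctured disc around `z₁` inside `U n` (co-discreteness) and a disc inside `Pᶜ` (`P` closed)
  obtain ⟨ε₁, hε₁, hU1⟩ : ∃ ε₁ > 0, ∀ s : ℂ, dist s z₁ < ε₁ → s ≠ z₁ → s ∈ U (max n₀ ⌈‖z₁‖⌉₊) := by
    have h1 := hUcd _ hn z₁ hball
    rw [eventually_nhdsWithin_iff, Metric.eventually_nhds_iff] at h1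
    obtain ⟨ε, hε, hε'⟩ := h1
    exact ⟨ε, hε, fun s hs hne => hε' hs hne⟩
  obtain ⟨ε₂, hε₂, hP2⟩ := Metric.isOpen_iff.1 hPc.isOpen_compl z₁ hz₁
  have hR : 0 < min ε₁ ε₂ / 2 := by positivity
  have hRR' : min ε₁ ε₂ / 2 < min ε₁ ε₂ := by linarith [lt_min hε₁ hε₂]
  -- the circle of radius `min ε₁ ε₂ ∕ 2` lies in the good set; §1 + compactness bound `Ec` on circle × `K`
  have hSD : sphere z₁ (min ε₁ ε₂ / 2) ⊆ U (max n₀ ⌈‖z₁‖⌉₊) ∩ Pᶜ := by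
    intro s hs
    rw [mem_sphere] at hs
    refine ⟨hU1 s (by linarith [min_le_left ε₁ ε₂]) ?_, hP2 (mem_ball.2 (by linarith [min_le_right ε₁ ε₂]))⟩
    intro hse
    rw [hse, dist_self] at hs
    linarith
  obtain ⟨M, hM⟩ := exists_forall_norm_le_of_isCompact_of_locally_bounded Ec (isCompact_sphere z₁ (min ε₁ ε₂ / 2)) hSD hloc
  -- maximum principle on the disc (each `z ↦ Ec z g` is holomorphic on `ball z₁ (min ε₁ ε₂) ⊆ Pᶜ`)
  have hd : ∀ g ∈ K, DifferentiableOn ℂ (fun z => Ec z g) (ball z₁ (min ε₁ ε₂)) := fun g _ =>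
    (hEdiff g).mono fun z hz => hP2 (ball_subset_ball (min_le_right _ _) hz)
  have hMb := norm_le_of_sphere_bound (Φ := fun g z => Ec z g) hR hRR' hd (fun g hg w hw => hM w hw g hg)
  exact ⟨closedBall z₁ (min ε₁ ε₂ / 2), closedBall_mem_nhds z₁ hR, M, fun z hz g hg => hMb g hg z hz⟩

/-! ## §3 The (V) road's binder bytes -/

/-- **`hEbd` IN the N = 2 consumers' BYTES**: on `{1 < Re} ∖ Sp` — provided the pole ledger places it off the pole set, `{1 < Re} ∖ Sp ⊆ Pᶜ` (K2E2-p12's (c)) — the continued family satisfies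
`∀ z₁ ∈ {1<Re} ∖ Sp, ∀ K, IsCompact K → ∃ V ∈ 𝓝 z₁, ∃ M, ∀ z ∈ V, ∀ g ∈ K, ‖Ec z g‖ ≤ M` (§2). [cite: BernsteinLapid2019, Thm 2.3, §4] [cite: MoeglinWaldspurger1995, IV.1.8–IV.1.11] -/
theorem hEbd_of_core_letters_cm_two (n₀ : ℕ) (k : ℕ → ℕ)
    {I : ℕ → Type} (h : (n : ℕ) → I n → (quasiSplit (↥(maximalRealSubfield L)) L (IsCMField.complexConj L) 2).Adelic → ℂ) (hhc : ∀ n i, Continuous (h n i)) (hhs : ∀ n i, HasCompactSupport (h n i))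
    (hreal : ∀ n i x, conj (h n i x) = h n i x)
    (ŝ : (n : ℕ) → I n → ℂ → ℂ) (hŝ : ∀ n i, Differentiable ℂ (ŝ n i))
    (hcov : ∀ n : ℕ, n₀ ≤ n → ∀ z ∈ Metric.ball (0 : ℂ) (n + 2), ∃ i, (ŝ n i z) ≠ 0)
    {U : ℕ → Set ℂ} (hUo : ∀ n : ℕ, n₀ ≤ n → IsOpen (U n)) (hUD : ∀ n : ℕ, n₀ ≤ n → U n ⊆ Metric.ball (0 : ℂ) (n + 2))
    (hUcd : ∀ n : ℕ, n₀ ≤ n → ∀ z₀ ∈ Metric.ball (0 : ℂ) (n + 2), ∀ᶠ s in 𝓝[≠] z₀, s ∈ U n)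
    (vX : (n : ℕ) → ℂ → HX (↥(maximalRealSubfield L)) L (IsCMField.complexConj L) 2 (k n) μ) (hvXd : ∀ n : ℕ, n₀ ≤ n → DifferentiableOn ℂ (vX n) (U n))
    {Ec : ℂ → (quasiSplit (↥(maximalRealSubfield L)) L (IsCMField.complexConj L) 2).Adelic → ℂ} {P : Set ℂ} (hPc : IsClosed P) (hEdiff : ∀ g, DifferentiableOn ℂ (fun z => Ec z g) Pᶜ)
    (hE5 : ∀ g (n : ℕ), n₀ ≤ n → ∀ j, ∀ z ∈ U n, z ∉ P → (ŝ n j z) ≠ 0 →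
      Ec z g = (ŝ n j z)⁻¹ * ∫ y, h n j y * ((vX n z : HX (↥(maximalRealSubfield L)) L (IsCMField.complexConj L) 2 (k n) μ) : (quasiSplit (↥(maximalRealSubfield L)) L (IsCMField.complexConj L) 2).automorphicQuotient → ℂ) ((quasiSplit (↥(maximalRealSubfield L)) L (IsCMField.complexConj L) 2).toAutomorphicQuotient (g * y)⁻¹) ∂νG)
    {Sp : Finset ℂ} (hSpP : ({z : ℂ | 1 < z.re} \ (↑Sp : Set ℂ)) ⊆ Pᶜ) :
    ∀ z₁ ∈ ({z : ℂ | 1 < z.re} \ (↑Sp : Set ℂ)), ∀ K : Set (quasiSplit (↥(maximalRealSubfield L)) L (IsCMField.complexConj L) 2).Adelic, IsCompact K → ∃ V ∈ 𝓝 z₁, ∃ M : ℝ, ∀ z ∈ V, ∀ g ∈ K, ‖Ec z g‖ ≤ M :=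
  fun z₁ hz₁ K hK => locally_bounded_of_core_letters_cm_two L μ νG n₀ k h hhc hhs hreal ŝ hŝ hcov hUo hUD hUcd vX hvXd hPc hEdiff hE5 z₁ (hSpP hz₁) K hK

end Summit.HodgeConjecture.HodgeConjecture.Cruxes.H413.K2E1ChiEisensteinJointLocalBoundCMTwo

end
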